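import Summits.QuantumFields.QCD.Theorems.ExtinctionBuildsQCD.Negative.WithoutTightCollapse
import Literature.Barriers.QuantumFields.WilsonDeterminantSign
import Literature.MathematicalPhysics.QuantumLattice.OverlapLocality
import Literature.MathematicalPhysics.QuantumFieldTheory.QCDPhaseQuenched
import Mathlib.Analysis.Matrix.HermitianFunctionalCalculus
import Mathlib.Data.Real.Sign

/-!
# Stub `stub_aizenmanGrafInMean` of line `weyl-window` (crux `SpectralDefectExtinction.ExtinctionBuildsQCD`,
# item stmt-QuantumFields-8968) — the Aizenman–Graf bound IN MEAN under a probability measure on gauge fields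

Part 3/4 of the composed stub `stub_fermiProjectorScreening` (band screening ⇒ Fermi-projector screening; lead seat c2,
cycle 2).  For a probability measure `ν` on `SU(3)` gauge fields of `(ℤ/T)⁴`, `|m₀| ≤ 1`, sites `x, y`, `0 < s < 1`,
`B ≥ 0` and the FRACTIONAL-MOMENT bound `∫ Σ_{p,q}‖(H_W(U,m₀) − iη)⁻¹((x',p),(y',q))‖^s dν ≤ B` (`η ∈ (0,1]`, both
orientations): `∫ Σ_{p,q}‖sgn(H_W(U,m₀))((x,p),(y,q))‖ dν ≤ 2B/s + 10368·exp(−‖x−y‖₁/400)`.  Hypotheses `h2a`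
(landed `stub_signKernelResolventBound`, entry bound `‖G(η)(a,b)‖ ≤ 1/|η|`), `h2c` (landed
`stub_hermitianWilsonCombesThomas`), `hPW` (landed `stub_aizenmanGrafPointwise`).  Proof: Tonelli (resolvent entries
jointly measurable in `(U, η)`: inverse = `det⁻¹ • adjugate` of a continuous matrix); on `η ∈ (0,1]`:
`‖G‖ ≤ ‖G‖^s η^{s−1}`, `∫₀¹ η^{s−1} = 1/s`; on `(1, 18]`: Combes–Thomas.  Aizenman–Graf, J. Phys. A 31 (1998) 6783, §2.
-/

noncomputable section

namespace Summit.QuantumFields.QCD.Cruxes.ExtinctionBuildsQCD.WeylWindow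

open scoped BigOperators ENNReal ComplexConjugate
open Filter MeasureTheory Matrix Finset
open Literature.MathematicalPhysics.QuantumLattice Literature.MathematicalPhysics.QuantumFieldTheory
  Literature.Probability.LatticeModels

/-! ## Measurability of the resolvent entries in `(U, η)` -/

section Measurability

variable {T : ℕ} [NeZero T]

/-- The shifted Hermitian Wilson operator `(U, η) ↦ H_W(U, m₀) − iη·1` is continuous. -/
theorem continuous_hW_sub_smul (m₀ : ℝ) :
    Continuous fun z : GaugeConfig 4 T SU3 × ℝ =>
      (spinorLift gammaFive * wilsonDirac (fundamentalRep (Fin 3)) z.1 m₀ 1 -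
        ((z.2 : ℂ) * Complex.I) • (1 : Matrix (TorusSite 4 T × Fin 3 × Fin 4) (TorusSite 4 T × Fin 3 × Fin 4) ℂ)) := by
  refine Continuous.sub ?_ ?_
  · exact continuous_const.mul
      ((continuous_wilsonDirac (fundamentalRep (Fin 3)) (continuous_fundamentalRep (Fin 3)) m₀ 1).comp
        continuous_fst)
  · exact ((Complex.continuous_ofReal.comp continuous_snd).mul continuous_const).smul continuous_const

/-- **Joint measurability** of `(U, η) ↦ ((H_W(U, m₀) − iη)⁻¹)(a, b)` (inverse = `det⁻¹ • adjugate`,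
a measurable function of the continuous matrix). -/
theorem measurable_resolvent_apply (m₀ : ℝ) (a b : TorusSite 4 T × Fin 3 × Fin 4) :
    Measurable fun z : GaugeConfig 4 T SU3 × ℝ =>
      ((spinorLift gammaFive * wilsonDirac (fundamentalRep (Fin 3)) z.1 m₀ 1 -
        ((z.2 : ℂ) * Complex.I) • 1)⁻¹ : Matrix (TorusSite 4 T × Fin 3 × Fin 4) (TorusSite 4 T × Fin 3 × Fin 4) ℂ) a b := by
  have hM := continuous_hW_sub_smul (T := T) m₀
  have h : (fun z : GaugeConfig 4 T SU3 × ℝ =>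
      ((spinorLift gammaFive * wilsonDirac (fundamentalRep (Fin 3)) z.1 m₀ 1 -
        ((z.2 : ℂ) * Complex.I) • 1)⁻¹ : Matrix (TorusSite 4 T × Fin 3 × Fin 4) (TorusSite 4 T × Fin 3 × Fin 4) ℂ) a b) =
      fun z => ((spinorLift gammaFive * wilsonDirac (fundamentalRep (Fin 3)) z.1 m₀ 1 -
        ((z.2 : ℂ) * Complex.I) • (1 : Matrix (TorusSite 4 T × Fin 3 × Fin 4) (TorusSite 4 T × Fin 3 × Fin 4) ℂ)).det)⁻¹ *
        (spinorLift gammaFive * wilsonDirac (fundamentalRep (Fin 3)) z.1 m₀ 1 -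
          ((z.2 : ℂ) * Complex.I) • (1 : Matrix (TorusSite 4 T × Fin 3 × Fin 4) (TorusSite 4 T × Fin 3 × Fin 4) ℂ)).adjugate a b := by
    funext z
    rw [Matrix.inv_def, Ring.inverse_eq_inv', Matrix.smul_apply, smul_eq_mul]
  rw [h]
  exact (hM.matrix_det.measurable.inv).mul ((hM.matrix_adjugate).matrix_elem a b).measurable

end Measurability

/-! ## Scalar helpers -/

section Helpers

/-- For `0 ≤ g ≤ η⁻¹`, `0 < s < 1`: `g ≤ g^s · η^{s−1}`. -/
theorem le_rpow_mul_rpow_of_le_inv {g η s : ℝ} (hg : 0 ≤ g) (hη : 0 < η) (hgη : g ≤ η⁻¹)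
    (hs0 : 0 < s) (hs1 : s < 1) : g ≤ g ^ s * η ^ (s - 1) := by
  have h1 : g = g ^ s * g ^ (1 - s) := by
    rw [← Real.rpow_add' hg (by linarith : s + (1 - s) ≠ 0)]
    norm_num
  have h2 : g ^ (1 - s) ≤ (η⁻¹) ^ (1 - s) := Real.rpow_le_rpow hg hgη (by linarith)
  have h3 : (η⁻¹) ^ (1 - s) = η ^ (s - 1) := by
    rw [Real.inv_rpow hη.le, ← Real.rpow_neg hη.le]
    congr 1
    ring
  calc g = g ^ s * g ^ (1 - s) := h1
    _ ≤ g ^ s * (η⁻¹) ^ (1 - s) := mul_le_mul_of_nonneg_left h2 (Real.rpow_nonneg hg s)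
    _ = g ^ s * η ^ (s - 1) := by rw [h3]

/-- `∫⁻_{(0,1]} η^{s−1} dη = 1/s` for `s > 0`. -/
theorem lintegral_rpow_Ioc_zero_one {s : ℝ} (hs0 : 0 < s) :
    ∫⁻ η in Set.Ioc (0 : ℝ) 1, ENNReal.ofReal (η ^ (s - 1)) = ENNReal.ofReal (1 / s) := by
  have hr : -1 < s - 1 := by linarith
  have hint : IntervalIntegrable (fun η : ℝ => η ^ (s - 1)) volume 0 1 :=
    intervalIntegral.intervalIntegrable_rpow' hr
  have hIO : IntegrableOn (fun η : ℝ => η ^ (s - 1)) (Set.Ioc 0 1) volume :=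
    (intervalIntegrable_iff_integrableOn_Ioc_of_le zero_le_one).1 hint
  rw [← ofReal_integral_eq_lintegral_ofReal hIO
    ((ae_restrict_iff' measurableSet_Ioc).2 (Eventually.of_forall fun η hη =>
      Real.rpow_nonneg hη.1.le _))]
  congr 1
  rw [← intervalIntegral.integral_of_le zero_le_one, integral_rpow (Or.inl hr)]
  rw [sub_add_cancel, Real.one_rpow, Real.zero_rpow hs0.ne']; ring


/-- Counting the colour–spin block: `Σ_{p,q : Fin 3 × Fin 4} c = 144 c` in `ℝ`. -/
theorem sum_sum_const_real (c : ℝ) :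
    ∑ _p : Fin 3 × Fin 4, ∑ _q : Fin 3 × Fin 4, c = 144 * c := by
  simp only [Finset.sum_const, Finset.card_univ, Fintype.card_prod, Fintype.card_fin, nsmul_eq_mul]
  push_cast; ring


end Helpers

/-! ## The bound in mean -/

section InMean

variable {T : ℕ} [NeZero T]

/-- **Stub `stub_aizenmanGrafInMean` — the Aizenman–Graf bound in mean (Wilson instance, abstract probability
measure).** See the module docstring. -/
theorem stub_aizenmanGrafInMean :
    (∀ (ι : Type) [Fintype ι] [DecidableEq ι] (H : Matrix ι ι ℂ), H.IsHermitian → ∀ (Y : ℝ), 0 < Y →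
      ∀ x y : ι,
        (∀ η : ℝ, η ≠ 0 → ‖(H - ((η : ℂ) * Complex.I) • (1 : Matrix ι ι ℂ))⁻¹ x y‖ ≤ |η|⁻¹) ∧
        ‖(Real.pi : ℂ) * (cfc Real.sign H) x y -
            2 * (cfc (fun t : ℝ => Real.arctan (t / Y)) H) x y‖ₑ ≤
          ∫⁻ η in Set.Ioc (0 : ℝ) Y, (‖(H - ((η : ℂ) * Complex.I) • (1 : Matrix ι ι ℂ))⁻¹ x y‖ₑ +
            ‖(H - ((η : ℂ) * Complex.I) • (1 : Matrix ι ι ℂ))⁻¹ y x‖ₑ)) →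
    (∀ (L : ℕ) [NeZero L] (U : GaugeConfig 4 L SU3) (m₀ η : ℝ), 1 ≤ |η| →
      ∀ (p q : TorusSite 4 L × Fin 3 × Fin 4),
        ‖((spinorLift gammaFive * wilsonDirac (fundamentalRep (Fin 3)) U m₀ 1 -
            ((η : ℂ) * Complex.I) • 1)⁻¹ :
            Matrix (TorusSite 4 L × Fin 3 × Fin 4) (TorusSite 4 L × Fin 3 × Fin 4) ℂ) p q‖ ≤
          2 * Real.exp (-((torusTaxiDist p.1 q.1 : ℝ) / 400))) →
    (∀ (T : ℕ) [NeZero T] (U : GaugeConfig 4 T SU3) (m₀ : ℝ), |m₀| ≤ 1 → ∀ (x y : TorusSite 4 T),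
      ENNReal.ofReal (Real.pi * ∑ p : Fin 3 × Fin 4, ∑ q : Fin 3 × Fin 4,
        ‖(cfc Real.sign (spinorLift gammaFive * wilsonDirac (fundamentalRep (Fin 3)) U m₀ 1) :
          Matrix (TorusSite 4 T × Fin 3 × Fin 4) (TorusSite 4 T × Fin 3 × Fin 4) ℂ) (x, p) (y, q)‖) ≤
      (∑ p : Fin 3 × Fin 4, ∑ q : Fin 3 × Fin 4, ∫⁻ η in Set.Ioc (0 : ℝ) (2 * 9),
        (‖((spinorLift gammaFive * wilsonDirac (fundamentalRep (Fin 3)) U m₀ 1 - ((η : ℂ) * Complex.I) • 1)⁻¹ :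
            Matrix (TorusSite 4 T × Fin 3 × Fin 4) (TorusSite 4 T × Fin 3 × Fin 4) ℂ) (x, p) (y, q)‖ₑ +
         ‖((spinorLift gammaFive * wilsonDirac (fundamentalRep (Fin 3)) U m₀ 1 - ((η : ℂ) * Complex.I) • 1)⁻¹ :
            Matrix (TorusSite 4 T × Fin 3 × Fin 4) (TorusSite 4 T × Fin 3 × Fin 4) ℂ) (y, q) (x, p)‖ₑ)) +
      ENNReal.ofReal (576 * (1 / 2) ^ torusTaxiDist x y)) →
    ∀ (T : ℕ) [NeZero T] (ν : Measure (GaugeConfig 4 T SU3)) [IsProbabilityMeasure ν] (m₀ : ℝ), |m₀| ≤ 1 →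
      ∀ (x y : TorusSite 4 T) (s B : ℝ), 0 < s → s < 1 → 0 ≤ B →
      (∀ η : ℝ, 0 < η → η ≤ 1 → ∀ x' y' : TorusSite 4 T, (x' = x ∧ y' = y) ∨ (x' = y ∧ y' = x) →
        ∫ U, (∑ p : Fin 3 × Fin 4, ∑ q : Fin 3 × Fin 4,
          ‖((spinorLift gammaFive * wilsonDirac (fundamentalRep (Fin 3)) U m₀ 1 -
              ((η : ℂ) * Complex.I) • 1)⁻¹ :
              Matrix (TorusSite 4 T × Fin 3 × Fin 4) (TorusSite 4 T × Fin 3 × Fin 4) ℂ) (x', p) (y', q)‖ ^ s) ∂ν ≤ B) →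
      ∫ U, (∑ p : Fin 3 × Fin 4, ∑ q : Fin 3 × Fin 4,
          ‖(cfc Real.sign (spinorLift gammaFive * wilsonDirac (fundamentalRep (Fin 3)) U m₀ 1) :
            Matrix (TorusSite 4 T × Fin 3 × Fin 4) (TorusSite 4 T × Fin 3 × Fin 4) ℂ) (x, p) (y, q)‖) ∂ν ≤
        2 * B / s + 10368 * Real.exp (-((torusTaxiDist x y : ℝ) / 400))  := by
  intro h2a h2c hPW T _ ν _ m₀ hm₀ x y s B hs0 hs1 hB hFM
  obtain ⟨Hw, hHw⟩ : ∃ Hw : GaugeConfig 4 T SU3 →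
      Matrix (TorusSite 4 T × Fin 3 × Fin 4) (TorusSite 4 T × Fin 3 × Fin 4) ℂ,
      ∀ U, Hw U = spinorLift gammaFive * wilsonDirac (fundamentalRep (Fin 3)) U m₀ 1 :=
    ⟨_, fun _ => rfl⟩
  obtain ⟨G, hG⟩ : ∃ G : GaugeConfig 4 T SU3 → ℝ →
      Matrix (TorusSite 4 T × Fin 3 × Fin 4) (TorusSite 4 T × Fin 3 × Fin 4) ℂ,
      ∀ U η, G U η = (Hw U - ((η : ℂ) * Complex.I) •
        (1 : Matrix (TorusSite 4 T × Fin 3 × Fin 4) (TorusSite 4 T × Fin 3 × Fin 4) ℂ))⁻¹ :=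
    ⟨_, fun _ _ => rfl⟩
  -- the hypotheses and the goal in this currency
  have hFM' : ∀ η : ℝ, 0 < η → η ≤ 1 → ∀ x' y' : TorusSite 4 T, (x' = x ∧ y' = y) ∨ (x' = y ∧ y' = x) →
      ∫ U, (∑ p : Fin 3 × Fin 4, ∑ q : Fin 3 × Fin 4, ‖G U η (x', p) (y', q)‖ ^ s) ∂ν ≤ B := by
    simpa only [← hHw, ← hG] using hFM
  have h2c' : ∀ (U : GaugeConfig 4 T SU3) (η : ℝ), 1 ≤ |η| → ∀ p q : TorusSite 4 T × Fin 3 × Fin 4,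
      ‖G U η p q‖ ≤ 2 * Real.exp (-((torusTaxiDist p.1 q.1 : ℝ) / 400)) := by
    intro U η hη p q
    simpa only [← hHw, ← hG] using h2c T U m₀ η hη p q
  simp only [← hHw]
  set d : ℕ := torusTaxiDist x y with hd
  have hHerm : ∀ U, (Hw U).IsHermitian := fun U => by
    rw [hHw]
    exact Literature.Barriers.QuantumFields.WilsonDeterminant.isHermitian_hermitianWilsonDirac _
      (fun g => fundamentalRep_mem_unitaryGroup g) U m₀ 1
  obtain ⟨F, hF⟩ : ∃ F : GaugeConfig 4 T SU3 → ℝ, ∀ U, F U = ∑ p : Fin 3 × Fin 4, ∑ q : Fin 3 × Fin 4,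
      ‖(cfc Real.sign (Hw U)) (x, p) (y, q)‖ := ⟨_, fun _ => rfl⟩
  simp only [← hF]
  obtain ⟨g, hg⟩ : ∃ g : GaugeConfig 4 T SU3 → ℝ → ℝ≥0∞, ∀ U η, g U η =
      ∑ p : Fin 3 × Fin 4, ∑ q : Fin 3 × Fin 4, (‖G U η (x, p) (y, q)‖ₑ + ‖G U η (y, q) (x, p)‖ₑ) :=
    ⟨_, fun _ _ => rfl⟩
  set R : ℝ := 576 * (1 / 2) ^ d with hR
  -- measurability
  have hmeasG : ∀ a c : TorusSite 4 T × Fin 3 × Fin 4,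
      Measurable fun z : GaugeConfig 4 T SU3 × ℝ => G z.1 z.2 a c := by
    intro a c
    simp only [hG, hHw]
    exact measurable_resolvent_apply m₀ a c
  have hmeas_g : Measurable (Function.uncurry g) := by
    have : Function.uncurry g = fun z : GaugeConfig 4 T SU3 × ℝ =>
        ∑ p : Fin 3 × Fin 4, ∑ q : Fin 3 × Fin 4, (‖G z.1 z.2 (x, p) (y, q)‖ₑ + ‖G z.1 z.2 (y, q) (x, p)‖ₑ) := by
      funext z
      exact hg z.1 z.2
    rw [this]
    refine Finset.measurable_sum _ fun p _ => Finset.measurable_sum _ fun q _ => ?_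
    exact ((hmeasG (x, p) (y, q)).enorm).add ((hmeasG (y, q) (x, p)).enorm)
  have hmeas_term : ∀ (U : GaugeConfig 4 T SU3) (p q : Fin 3 × Fin 4),
      Measurable fun η : ℝ => ‖G U η (x, p) (y, q)‖ₑ + ‖G U η (y, q) (x, p)‖ₑ := fun U p q =>
    (((hmeasG (x, p) (y, q)).comp (measurable_prodMk_left (x := U))).enorm).add
      (((hmeasG (y, q) (x, p)).comp (measurable_prodMk_left (x := U))).enorm)
  -- ### Step P: the pointwise Aizenman–Graf bound (landed `stub_aizenmanGrafPointwise`)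
  have hpoint : ∀ U, ENNReal.ofReal (Real.pi * F U) ≤
      (∫⁻ η in Set.Ioc (0 : ℝ) (2 * 9), g U η) + ENNReal.ofReal R := by
    intro U
    have h := hPW T U m₀ hm₀ x y
    simp only [← hHw, ← hG, ← hF] at h
    have hinner : ∀ p : Fin 3 × Fin 4,
        ∑ q : Fin 3 × Fin 4, (∫⁻ η in Set.Ioc (0 : ℝ) (2 * 9),
          (‖G U η (x, p) (y, q)‖ₑ + ‖G U η (y, q) (x, p)‖ₑ)) =
        ∫⁻ η in Set.Ioc (0 : ℝ) (2 * 9), ∑ q : Fin 3 × Fin 4,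
          (‖G U η (x, p) (y, q)‖ₑ + ‖G U η (y, q) (x, p)‖ₑ) := fun p =>
      (lintegral_finsetSum _ fun q _ => hmeas_term U p q).symm
    rw [Finset.sum_congr rfl fun p _ => hinner p,
      ← lintegral_finsetSum _ fun p _ => Finset.measurable_sum _ fun q _ => hmeas_term U p q] at h
    exact h.trans (le_of_eq (congrArg (· + ENNReal.ofReal R) (lintegral_congr fun η => (hg U η).symm)))
  -- ### Step K: the bound at fixed `η`
  have hK_small : ∀ η : ℝ, 0 < η → η ≤ 1 →
      ∫⁻ U, g U η ∂ν ≤ ENNReal.ofReal (2 * B * η ^ (s - 1)) := by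
    intro η hη0 hη1
    -- each orientation separately
    have horient : ∀ x' y' : TorusSite 4 T, ((x' = x ∧ y' = y) ∨ (x' = y ∧ y' = x)) →
        ∫⁻ U, (∑ p : Fin 3 × Fin 4, ∑ q : Fin 3 × Fin 4, ‖G U η (x', p) (y', q)‖ₑ) ∂ν ≤
          ENNReal.ofReal (B * η ^ (s - 1)) := by
      intro x' y' hxy
      set f : GaugeConfig 4 T SU3 → ℝ := fun U => ∑ p : Fin 3 × Fin 4, ∑ q : Fin 3 × Fin 4,
        ‖G U η (x', p) (y', q)‖ ^ s with hf
      have hf_meas : Measurable f := by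
        refine Finset.measurable_sum _ fun p _ => Finset.measurable_sum _ fun q _ => ?_
        exact (((hmeasG (x', p) (y', q)).comp (measurable_prodMk_right (y := η))).norm).pow_const _
      have hf_nn : ∀ U, 0 ≤ f U := fun U =>
        Finset.sum_nonneg fun p _ => Finset.sum_nonneg fun q _ => Real.rpow_nonneg (norm_nonneg _) _
      have hentry_le : ∀ U p q, ‖G U η (x', p) (y', q)‖ ≤ η⁻¹ := by
        intro U p q
        have := (h2a (TorusSite 4 T × Fin 3 × Fin 4) (Hw U) (hHerm U) 1 one_pos (x', p) (y', q)).1 η hη0.ne'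
        rw [abs_of_pos hη0, ← hG] at this
        exact this
      have hf_bdd : ∀ U, ‖f U‖ ≤ 144 * (η⁻¹) ^ s := by
        intro U
        rw [Real.norm_of_nonneg (hf_nn U), hf]
        calc _ ≤ ∑ _p : Fin 3 × Fin 4, ∑ _q : Fin 3 × Fin 4, (η⁻¹) ^ s :=
              Finset.sum_le_sum fun p _ => Finset.sum_le_sum fun q _ =>
                Real.rpow_le_rpow (norm_nonneg _) (hentry_le U p q) hs0.le
          _ = 144 * (η⁻¹) ^ s := sum_sum_const_real _
      have hf_int : Integrable f ν :=
        Integrable.of_bound hf_meas.aestronglyMeasurable _ (Eventually.of_forall hf_bdd)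
      -- pointwise `Σ‖G‖ ≤ η^{s-1} Σ‖G‖^s`
      have hpt : ∀ U, (∑ p : Fin 3 × Fin 4, ∑ q : Fin 3 × Fin 4, ‖G U η (x', p) (y', q)‖ₑ) ≤
          ENNReal.ofReal (η ^ (s - 1) * f U) := by
        intro U
        rw [hf, Finset.mul_sum, ENNReal.ofReal_sum_of_nonneg (fun p _ => mul_nonneg
          (Real.rpow_nonneg hη0.le _) (Finset.sum_nonneg fun q _ => Real.rpow_nonneg (norm_nonneg _) _))]
        refine Finset.sum_le_sum fun p _ => ?_
        rw [Finset.mul_sum, ENNReal.ofReal_sum_of_nonneg (fun q _ => mul_nonneg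
          (Real.rpow_nonneg hη0.le _) (Real.rpow_nonneg (norm_nonneg _) _))]
        refine Finset.sum_le_sum fun q _ => ?_
        rw [← ofReal_norm]
        refine ENNReal.ofReal_le_ofReal ?_
        rw [mul_comm]
        exact le_rpow_mul_rpow_of_le_inv (norm_nonneg _) hη0 (hentry_le U p q) hs0 hs1
      calc ∫⁻ U, (∑ p : Fin 3 × Fin 4, ∑ q : Fin 3 × Fin 4, ‖G U η (x', p) (y', q)‖ₑ) ∂ν
          ≤ ∫⁻ U, ENNReal.ofReal (η ^ (s - 1) * f U) ∂ν := lintegral_mono fun U => hpt U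
        _ = ENNReal.ofReal (η ^ (s - 1)) * ∫⁻ U, ENNReal.ofReal (f U) ∂ν := by
            rw [← lintegral_const_mul' _ _ ENNReal.ofReal_ne_top]
            refine lintegral_congr fun U => ?_
            rw [ENNReal.ofReal_mul (Real.rpow_nonneg hη0.le _)]
        _ = ENNReal.ofReal (η ^ (s - 1)) * ENNReal.ofReal (∫ U, f U ∂ν) := by
            rw [ofReal_integral_eq_lintegral_ofReal hf_int (Eventually.of_forall hf_nn)]
        _ ≤ ENNReal.ofReal (η ^ (s - 1)) * ENNReal.ofReal B := by
            refine mul_le_mul_right (ENNReal.ofReal_le_ofReal ?_) _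
            exact hFM' η hη0 hη1 x' y' hxy
        _ = ENNReal.ofReal (B * η ^ (s - 1)) := by
            rw [← ENNReal.ofReal_mul (Real.rpow_nonneg hη0.le _), mul_comm]
    -- the two orientations
    have h1 := horient x y (Or.inl ⟨rfl, rfl⟩)
    have h2 := horient y x (Or.inr ⟨rfl, rfl⟩)
    have hsplit : ∀ U, g U η = (∑ p : Fin 3 × Fin 4, ∑ q : Fin 3 × Fin 4, ‖G U η (x, p) (y, q)‖ₑ) +
        (∑ p : Fin 3 × Fin 4, ∑ q : Fin 3 × Fin 4, ‖G U η (y, p) (x, q)‖ₑ) := by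
      intro U
      rw [hg]
      simp only [Finset.sum_add_distrib]
      congr 1
      exact Finset.sum_comm
    calc ∫⁻ U, g U η ∂ν = (∫⁻ U, (∑ p : Fin 3 × Fin 4, ∑ q : Fin 3 × Fin 4, ‖G U η (x, p) (y, q)‖ₑ) ∂ν) +
          ∫⁻ U, (∑ p : Fin 3 × Fin 4, ∑ q : Fin 3 × Fin 4, ‖G U η (y, p) (x, q)‖ₑ) ∂ν := by
          rw [← lintegral_add_left]
          · exact lintegral_congr fun U => hsplit U
          · refine Finset.measurable_sum _ fun p _ => Finset.measurable_sum _ fun q _ => ?_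
            exact ((hmeasG (x, p) (y, q)).comp (measurable_prodMk_right (y := η))).enorm
      _ ≤ ENNReal.ofReal (B * η ^ (s - 1)) + ENNReal.ofReal (B * η ^ (s - 1)) := add_le_add h1 h2
      _ = ENNReal.ofReal (2 * B * η ^ (s - 1)) := by
          rw [← ENNReal.ofReal_add (by positivity) (by positivity)]; congr 1; ring
  have hK_large : ∀ η : ℝ, 1 ≤ η →
      ∫⁻ U, g U η ∂ν ≤ ENNReal.ofReal (576 * Real.exp (-((d : ℝ) / 400))) := by
    intro η hη1
    have hη : 1 ≤ |η| := hη1.trans (le_abs_self η)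
    have hpt : ∀ U, g U η ≤ ENNReal.ofReal (576 * Real.exp (-((d : ℝ) / 400))) := by
      intro U
      have hone : ∀ p q : Fin 3 × Fin 4,
          ‖G U η (x, p) (y, q)‖ₑ + ‖G U η (y, q) (x, p)‖ₑ ≤
            ENNReal.ofReal (4 * Real.exp (-((d : ℝ) / 400))) := by
        intro p q
        have ha := h2c' U η hη (x, p) (y, q)
        have hb' := h2c' U η hη (y, q) (x, p)
        simp only at ha hb'
        rw [torusTaxiDist_comm y x] at hb'
        rw [← ofReal_norm, ← ofReal_norm, ← ENNReal.ofReal_add (norm_nonneg _) (norm_nonneg _)]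
        refine ENNReal.ofReal_le_ofReal ?_
        rw [hd]
        linarith
      rw [hg]
      calc _ ≤ ∑ _p : Fin 3 × Fin 4, ∑ _q : Fin 3 × Fin 4,
            ENNReal.ofReal (4 * Real.exp (-((d : ℝ) / 400))) :=
            Finset.sum_le_sum fun p _ => Finset.sum_le_sum fun q _ => hone p q
        _ = ENNReal.ofReal (576 * Real.exp (-((d : ℝ) / 400))) := by
            rw [Finset.sum_congr rfl fun p _ =>
              (ENNReal.ofReal_sum_of_nonneg (fun q _ => by positivity)).symm,
              ← ENNReal.ofReal_sum_of_nonneg (fun p _ => Finset.sum_nonneg fun q _ => by positivity),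
              sum_sum_const_real]
            congr 1; ring
    calc ∫⁻ U, g U η ∂ν ≤ ∫⁻ _U, ENNReal.ofReal (576 * Real.exp (-((d : ℝ) / 400))) ∂ν :=
          lintegral_mono hpt
      _ = ENNReal.ofReal (576 * Real.exp (-((d : ℝ) / 400))) := by
          rw [lintegral_const, measure_univ, mul_one]
  -- ### Step I: integrate in `η` over `(0, 2b] = (0, 1] ∪ (1, 2b]`
  have hI : ∫⁻ η in Set.Ioc (0 : ℝ) (2 * 9), (∫⁻ U, g U η ∂ν) ≤
      ENNReal.ofReal (2 * B / s) + ENNReal.ofReal (9792 * Real.exp (-((d : ℝ) / 400))) := by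
    rw [← Set.Ioc_union_Ioc_eq_Ioc (zero_le_one) (by norm_num : (1 : ℝ) ≤ 2 * 9)]
    refine (lintegral_union_le _ _ _).trans (add_le_add ?_ ?_)
    · calc ∫⁻ η in Set.Ioc (0 : ℝ) 1, (∫⁻ U, g U η ∂ν)
          ≤ ∫⁻ η in Set.Ioc (0 : ℝ) 1, ENNReal.ofReal (2 * B) * ENNReal.ofReal (η ^ (s - 1)) := by
            refine setLIntegral_mono' measurableSet_Ioc fun η hη => ?_
            rw [← ENNReal.ofReal_mul (by positivity)]
            exact hK_small η hη.1 hη.2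
        _ = ENNReal.ofReal (2 * B) * ENNReal.ofReal (1 / s) := by
            rw [lintegral_const_mul' _ _ ENNReal.ofReal_ne_top, lintegral_rpow_Ioc_zero_one hs0]
        _ = ENNReal.ofReal (2 * B / s) := by
            rw [← ENNReal.ofReal_mul (by positivity)]; congr 1; ring
    · calc ∫⁻ η in Set.Ioc (1 : ℝ) (2 * 9), (∫⁻ U, g U η ∂ν)
          ≤ ∫⁻ _η in Set.Ioc (1 : ℝ) (2 * 9), ENNReal.ofReal (576 * Real.exp (-((d : ℝ) / 400))) :=
            setLIntegral_mono' measurableSet_Ioc fun η hη => hK_large η hη.1.le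
        _ = ENNReal.ofReal (576 * Real.exp (-((d : ℝ) / 400))) * ENNReal.ofReal (2 * 9 - 1) := by
            rw [setLIntegral_const, Real.volume_Ioc]
        _ ≤ ENNReal.ofReal (576 * Real.exp (-((d : ℝ) / 400))) * ENNReal.ofReal 17 :=
            mul_le_mul_right (ENNReal.ofReal_le_ofReal (by linarith)) _
        _ = ENNReal.ofReal (9792 * Real.exp (-((d : ℝ) / 400))) := by
            rw [← ENNReal.ofReal_mul (by positivity)]; congr 1; ring
  -- ### Step T: Tonelli and the lintegral bound
  have hlin : ∫⁻ U, ENNReal.ofReal (Real.pi * F U) ∂ν ≤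
      ENNReal.ofReal (2 * B / s + 9792 * Real.exp (-((d : ℝ) / 400)) + R) := by
    calc ∫⁻ U, ENNReal.ofReal (Real.pi * F U) ∂ν
        ≤ ∫⁻ U, ((∫⁻ η in Set.Ioc (0 : ℝ) (2 * 9), g U η) + ENNReal.ofReal R) ∂ν :=
          lintegral_mono hpoint
      _ = (∫⁻ U, (∫⁻ η in Set.Ioc (0 : ℝ) (2 * 9), g U η) ∂ν) + ENNReal.ofReal R := by
          rw [lintegral_add_right' _ aemeasurable_const, lintegral_const, measure_univ, mul_one]
      _ = (∫⁻ η in Set.Ioc (0 : ℝ) (2 * 9), (∫⁻ U, g U η ∂ν)) + ENNReal.ofReal R := by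
          rw [lintegral_lintegral_swap (hmeas_g.aemeasurable)]
      _ ≤ ENNReal.ofReal (2 * B / s) + ENNReal.ofReal (9792 * Real.exp (-((d : ℝ) / 400))) +
            ENNReal.ofReal R := add_le_add hI le_rfl
      _ = ENNReal.ofReal (2 * B / s + 9792 * Real.exp (-((d : ℝ) / 400)) + R) := by
          rw [← ENNReal.ofReal_add (by positivity) (by positivity),
            ← ENNReal.ofReal_add (by positivity) (by positivity)]
  -- ### Step F: back to the Bochner integral
  have hRle : R ≤ 576 * Real.exp (-((d : ℝ) / 400)) := by
    refine mul_le_mul_of_nonneg_left ?_ (by norm_num)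
    rw [show ((1 : ℝ) / 2) ^ d = Real.exp (-(Real.log 2 * d)) by
      rw [Real.exp_neg, Real.exp_mul, Real.exp_log two_pos, one_div, inv_pow, Real.rpow_natCast], Real.exp_le_exp]
    nlinarith [Real.log_two_gt_d9, (Nat.cast_nonneg d : (0 : ℝ) ≤ d)]
  have htotal : 2 * B / s + 9792 * Real.exp (-((d : ℝ) / 400)) + R ≤
      Real.pi * (2 * B / s + 10368 * Real.exp (-((d : ℝ) / 400))) := by
    have h0 : 0 ≤ 2 * B / s + 10368 * Real.exp (-((d : ℝ) / 400)) := by positivity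
    nlinarith [Real.pi_gt_three]
  have hFnn : ∀ U, 0 ≤ F U := fun U => by
    rw [hF]
    exact Finset.sum_nonneg fun p _ => Finset.sum_nonneg fun q _ => norm_nonneg _
  by_cases hFm : AEStronglyMeasurable F ν
  · have hπF : ∫ U, F U ∂ν = Real.pi⁻¹ * ∫ U, Real.pi * F U ∂ν := by
      rw [integral_const_mul, ← mul_assoc, inv_mul_cancel₀ Real.pi_pos.ne', one_mul]
    rw [hπF, integral_eq_lintegral_of_nonneg_ae
      (Eventually.of_forall fun U => mul_nonneg Real.pi_pos.le (hFnn U)) (hFm.const_mul Real.pi)]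
    have hfin : (∫⁻ U, ENNReal.ofReal (Real.pi * F U) ∂ν).toReal ≤
        Real.pi * (2 * B / s + 10368 * Real.exp (-((d : ℝ) / 400))) :=
      (ENNReal.toReal_le_of_le_ofReal (by positivity) (hlin.trans (ENNReal.ofReal_le_ofReal htotal)))
    calc Real.pi⁻¹ * (∫⁻ U, ENNReal.ofReal (Real.pi * F U) ∂ν).toReal
        ≤ Real.pi⁻¹ * (Real.pi * (2 * B / s + 10368 * Real.exp (-((d : ℝ) / 400)))) :=
          mul_le_mul_of_nonneg_left hfin (inv_nonneg.2 Real.pi_pos.le)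
      _ = 2 * B / s + 10368 * Real.exp (-((d : ℝ) / 400)) := by
          rw [← mul_assoc, inv_mul_cancel₀ Real.pi_pos.ne', one_mul]
  · rw [integral_non_aestronglyMeasurable hFm]
    positivity

end InMean

end Summit.QuantumFields.QCD.Cruxes.ExtinctionBuildsQCD.WeylWindow

end
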